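import Summits.KontsevichZagierPeriods.KontsevichZagierPeriods.Theorems.RootDecompRelativeModAbsoluteCylLogSplitP19

/-! # `RootDecompRelativeModAbsoluteCylLogSplitP20` — part 20/25 of the mechanical ≤330-line split of `CylLogSplit.lean`
(split by the decomp-kz census seat for landing; mathematics unchanged; part 20 continues part 19). -/

noncomputable section
open Set MeasureTheory Filter Topology
open scoped BigOperators
open Literature.NumberTheory.Transcendental Literature.ModelTheory.ExponentialFields

namespace Summit.KontsevichZagierPeriods.RootDecompRelativeModAbsolute.Rung30571

namespace RegularisedLogLayer

namespace CylLog
variable {b : ℕ}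

/-- `[G, f] ≡ Σ_c [C c, f]` for a finite disjoint semialgebraic partition of `G` UP TO A NULL SET. -/
theorem exists_restrict_parts_ae {n N : ℕ} {G : Set (Fin n → ℝ)} (hG : IsSemialgebraic ℚ G)
    (C : Fin N → Set (Fin n → ℝ)) (hC : ∀ c, IsSemialgebraic ℚ (C c)) (hCG : ∀ c, C c ⊆ G)
    (hdisj : Pairwise (Function.onFun Disjoint C)) (hnull : volume (G \ ⋃ c, C c) = 0)
    (R : KZ.IntegralRep n) (hRd : R.domain = G) :
    ∃ Rc : Fin N → KZ.IntegralRep n, (∀ c, (Rc c).domain = C c) ∧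
      (∀ c, (Rc c).integrand = R.integrand) ∧ KZ.of R - ∑ c, KZ.of (Rc c) ∈ KZ.relations := by
  have hs : IsSemialgebraic ℚ (⋃ c, C c) := by
    simpa using IsSemialgebraic.biUnion Finset.univ C fun c _ => hC c
  have hsG : (⋃ c, C c) ⊆ G := iUnion_subset hCG
  have ht : IsSemialgebraic ℚ (G \ ⋃ c, C c) := hG.diff hs
  have hU : G = (⋃ c, C c) ∪ (G \ ⋃ c, C c) := (union_sdiff_cancel hsG).symm
  have hst : (⋃ c, C c) ∩ (G \ ⋃ c, C c) = ∅ := inter_sdiff_self _ _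
  have hsR : (⋃ c, C c) ⊆ R.domain := hRd ▸ hsG
  have htR : (G \ ⋃ c, C c) ⊆ R.domain := hRd ▸ sdiff_subset
  have hrel : KZ.of R - KZ.of (R.restrict _ hs hsR) - KZ.of (R.restrict _ ht htR) ∈ KZ.relations := by
    refine KZ.domainAddRel_subset_relations ⟨n, R, R.restrict _ hs hsR, R.restrict _ ht htR, ?_, ?_,
      fun _ _ => rfl, fun _ _ => rfl, rfl⟩
    · rw [KZ.IntegralRep.domain_restrict, KZ.IntegralRep.domain_restrict, ← hU]; exact hRd
    · rw [KZ.IntegralRep.domain_restrict, KZ.IntegralRep.domain_restrict, hst, measure_empty]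
  have hRt : KZ.of (R.restrict _ ht htR) ∈ KZ.relations :=
    KZ.of_mem_relations_of_volume_eq_zero _ (by rw [KZ.IntegralRep.domain_restrict]; exact hnull)
  obtain ⟨Rc, hd, hi, hrel'⟩ := exists_restrict_parts N C hC hdisj (R.restrict _ hs hsR) rfl
  refine ⟨Rc, hd, fun c => by simpa using hi c, ?_⟩
  have e : KZ.of R - ∑ c, KZ.of (Rc c) = (KZ.of R - KZ.of (R.restrict _ hs hsR) - KZ.of (R.restrict _ ht htR)) +
      KZ.of (R.restrict _ ht htR) + (KZ.of (R.restrict _ hs hsR) - ∑ c, KZ.of (Rc c)) := by abel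
  rw [e]
  exact add_mem (add_mem hrel hRt) hrel'

/-- **Orientation partition (glue D1 for the common value `L` of a relation).**  An open ℚ-sa base splits, up to a
null set, into the open ℚ-sa pieces `{L > 1}`, `{L < 1}` and the interior of `{L = 1}`. -/
theorem exists_orientation_partition {b : ℕ} {G : Set (Fin b → ℝ)} (hGo : IsOpen G)
    (hG : IsSemialgebraic ℚ G) {L : (Fin b → ℝ) → ℝ} (hL : IsSemialgebraicFunOn ℚ G L)
    (hLc : ContinuousOn L G) :
    ∃ C : Fin 3 → Set (Fin b → ℝ), (∀ c, IsSemialgebraic ℚ (C c) ∧ IsOpen (C c) ∧ C c ⊆ G) ∧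
      Pairwise (Function.onFun Disjoint C) ∧ volume (G \ ⋃ c, C c) = 0 ∧
      (∀ x ∈ C 0, 1 < L x) ∧ (∀ x ∈ C 1, L x < 1) ∧ (∀ x ∈ C 2, L x = 1) := by
  have h1sa : IsSemialgebraicFunOn ℚ G (fun _ => (1:ℝ)) :=
    (isSemialgebraicFunOn_ratCast hG 1).congr fun _ _ => by simp
  set A : Set (Fin b → ℝ) := {x | x ∈ G ∧ 1 < L x} with hA_def
  set B : Set (Fin b → ℝ) := {x | x ∈ G ∧ L x < 1} with hB_def
  set E : Set (Fin b → ℝ) := {x | x ∈ G ∧ L x = 1} with hE_def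
  have hA : IsSemialgebraic ℚ A := by
    convert (IsSemialgebraicFunOn.sub_holds h1sa hL).isSemialgebraic_sep_neg using 1
    ext x; simp only [hA_def, mem_setOf_eq, Pi.sub_apply, sub_neg]
  have hB : IsSemialgebraic ℚ B := by
    convert (IsSemialgebraicFunOn.sub_holds hL h1sa).isSemialgebraic_sep_neg using 1
    ext x; simp only [hB_def, mem_setOf_eq, Pi.sub_apply, sub_neg]
  have hE : IsSemialgebraic ℚ E := by
    have h : E = G \ (A ∪ B) := by
      ext x
      simp only [hA_def, hB_def, hE_def, mem_setOf_eq, Set.mem_sdiff, mem_union]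
      constructor
      · rintro ⟨hx, h⟩
        exact ⟨hx, by rintro (⟨_, h'⟩ | ⟨_, h'⟩) <;> linarith⟩
      · rintro ⟨hx, h⟩
        refine ⟨hx, ?_⟩
        by_contra hne
        rcases lt_or_gt_of_ne hne with h' | h'
        · exact h (Or.inr ⟨hx, h'⟩)
        · exact h (Or.inl ⟨hx, h'⟩)
    rw [h]
    exact hG.diff (hA.union hB)
  have hAo : IsOpen A := hLc.isOpen_inter_preimage hGo isOpen_Ioi
  have hBo : IsOpen B := hLc.isOpen_inter_preimage hGo isOpen_Iio
  have hI : IsSemialgebraic ℚ (interior E) := isSemialgebraic_interior hE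
  have hAB : Disjoint A B := Set.disjoint_left.mpr fun x hx hx' => by
    have h1 := hx.2; have h2 := hx'.2; linarith
  have hAI : Disjoint A (interior E) := Set.disjoint_left.mpr fun x hx hx' => by
    have h1 := hx.2; have h2 := (interior_subset hx').2; linarith
  have hBI : Disjoint B (interior E) := Set.disjoint_left.mpr fun x hx hx' => by
    have h1 := hx.2; have h2 := (interior_subset hx').2; linarith
  refine ⟨![A, B, interior E], ?_, ?_, ?_, fun x hx => ?_, fun x hx => ?_, fun x hx => ?_⟩
  · intro c
    fin_cases c
    · exact ⟨hA, hAo, fun x hx => hx.1⟩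
    · exact ⟨hB, hBo, fun x hx => hx.1⟩
    · exact ⟨hI, isOpen_interior, fun x hx => (interior_subset hx).1⟩
  · intro i j hij
    fin_cases i <;> fin_cases j
    all_goals (first | exact absurd rfl hij | skip)
    · exact hAB
    · exact hAI
    · exact hAB.symm
    · exact hBI
    · exact hAI.symm
    · exact hBI.symm
  · have hsub : G \ ⋃ c, (![A, B, interior E] : Fin 3 → Set (Fin b → ℝ)) c ⊆ E \ interior E := by
      intro x hx
      have hxG := hx.1
      have hno : ∀ c, x ∉ (![A, B, interior E] : Fin 3 → Set (Fin b → ℝ)) c :=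
        fun c hc => hx.2 (mem_iUnion.mpr ⟨c, hc⟩)
      have hxA : x ∉ A := hno 0
      have hxB : x ∉ B := hno 1
      have hxI : x ∉ interior E := hno 2
      refine ⟨⟨hxG, ?_⟩, hxI⟩
      by_contra hne
      rcases lt_or_gt_of_ne hne with h' | h'
      · exact hxB ⟨hxG, h'⟩
      · exact hxA ⟨hxG, h'⟩
    exact measure_mono_null hsub (KZ.volume_eq_zero_of_interior_eq_empty
      (isSemialgebraic_diff_interior hE).1 (isSemialgebraic_diff_interior hE).2)
  · exact (show x ∈ A from hx).2
  · exact (show x ∈ B from hx).2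
  · exact (interior_subset (show x ∈ interior E from hx)).2

/-! ### §3w D7 IN `LogStructure`'S CURRENCY: one exact relation `∏ W_i ^ (f i) = 1`, `f : Fin k → ℤ`, with ORIENTED
factors (`σ i = true`: `W_i ≥ 1`, cell `[band G 1 W_i]`; `σ i = false`: `0 < W_i ≤ 1`, reversed cell `[band G W_i 1]`)
— the multiplicity unrolling `Fin (∑ n i) → Fin k` feeding `regCells_mem_relations_of_relation` — PROVED -/

/-- Index expansion by multiplicity: `Fin (∑ i, n i) → Fin k`, hitting `i` exactly `n i` times. -/
def expandIdx {k : ℕ} (n : Fin k → ℕ) (j : Fin (∑ i, n i)) : Fin k := (finSigmaFinEquiv.symm j).1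

/-- Auxiliary step `expandIdx_pos`. [bookkeeping] -/
theorem expandIdx_pos {k : ℕ} (n : Fin k → ℕ) (j : Fin (∑ i, n i)) : 0 < n (expandIdx n j) :=
  Fin.pos (finSigmaFinEquiv.symm j).2

/-- Auxiliary step `prod_expandIdx`. [bookkeeping] -/
theorem prod_expandIdx {k : ℕ} {M : Type*} [CommMonoid M] (n : Fin k → ℕ) (g : Fin k → M) :
    ∏ j, g (expandIdx n j) = ∏ i, g i ^ n i := by
  unfold expandIdx
  rw [← finSigmaFinEquiv.prod_comp]
  simp only [Equiv.symm_apply_apply]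
  rw [← Finset.univ_sigma_univ, Finset.prod_sigma]
  simp

/-- Auxiliary step `sum_expandIdx`. [bookkeeping] -/
theorem sum_expandIdx {k : ℕ} {M : Type*} [AddCommMonoid M] (n : Fin k → ℕ) (g : Fin k → M) :
    ∑ j, g (expandIdx n j) = ∑ i, n i • g i := by
  unfold expandIdx
  rw [← finSigmaFinEquiv.sum_comp]
  simp only [Equiv.symm_apply_apply]
  rw [← Finset.univ_sigma_univ, Finset.sum_sigma]
  simp

/-- Auxiliary step `prod_expandIdx_apply`. [bookkeeping] -/
theorem prod_expandIdx_apply {k : ℕ} {α M : Type*} [CommMonoid M] (n : Fin k → ℕ) (W : Fin k → α → M) (x : α) :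
    ∏ j, W (expandIdx n j) x = ∏ i, W i x ^ n i :=
  prod_expandIdx n fun i => W i x

/-- Auxiliary step `sum_expandIdx_apply`. [bookkeeping] -/
theorem sum_expandIdx_apply {k : ℕ} {α M : Type*} [AddCommMonoid M] (n : Fin k → ℕ) (W : Fin k → α → M)
    (x : α) : ∑ j, W (expandIdx n j) x = ∑ i, n i • W i x :=
  sum_expandIdx n fun i => W i x

/-- The four multiplicity vectors of a relation `f : Fin k → ℤ` with orientation `σ`: positive exponents on
factors `≥ 1` / on factors `≤ 1`, negative exponents on factors `≥ 1` / `≤ 1`. -/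
def multUp {k : ℕ} (f : Fin k → ℤ) (σ : Fin k → Bool) (i : Fin k) : ℕ := if σ i = true then (f i).toNat else 0
/-- Auxiliary step `multUp'`. [bookkeeping] -/
def multUp' {k : ℕ} (f : Fin k → ℤ) (σ : Fin k → Bool) (i : Fin k) : ℕ := if σ i = false then (f i).toNat else 0
/-- Auxiliary step `multDn`. [bookkeeping] -/
def multDn {k : ℕ} (f : Fin k → ℤ) (σ : Fin k → Bool) (i : Fin k) : ℕ := if σ i = true then (-f i).toNat else 0
/-- Auxiliary step `multDn'`. [bookkeeping] -/
def multDn' {k : ℕ} (f : Fin k → ℤ) (σ : Fin k → Bool) (i : Fin k) : ℕ := if σ i = false then (-f i).toNat else 0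

/-- Auxiliary step `multUp_add_multUp'`. [bookkeeping] -/
theorem multUp_add_multUp' {k : ℕ} (f : Fin k → ℤ) (σ : Fin k → Bool) (i : Fin k) :
    multUp f σ i + multUp' f σ i = (f i).toNat := by
  cases h : σ i <;> simp [multUp, multUp', h]

/-- Auxiliary step `multDn_add_multDn'`. [bookkeeping] -/
theorem multDn_add_multDn' {k : ℕ} (f : Fin k → ℤ) (σ : Fin k → Bool) (i : Fin k) :
    multDn f σ i + multDn' f σ i = (-f i).toNat := by
  cases h : σ i <;> simp [multDn, multDn', h]

/-- Auxiliary step `mult_coef`. [bookkeeping] -/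
theorem mult_coef {k : ℕ} (f : Fin k → ℤ) (σ : Fin k → Bool) (i : Fin k) :
    ((multUp f σ i : ℤ) - multUp' f σ i) - ((multDn f σ i : ℤ) - multDn' f σ i) =
      if σ i then f i else -f i := by
  cases h : σ i <;> simp [multUp, multUp', multDn, multDn', h]
  all_goals omega

/-- Auxiliary step `toNat_sub_toNat_neg_real`. [bookkeeping] -/
theorem toNat_sub_toNat_neg_real (z : ℤ) : ((z.toNat : ℕ) : ℝ) - (((-z).toNat : ℕ) : ℝ) = (z : ℝ) := by
  have h := Int.toNat_sub_toNat_neg z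
  exact_mod_cast h

end CylLog
end RegularisedLogLayer
end Summit.KontsevichZagierPeriods.RootDecompRelativeModAbsolute.Rung30571
end
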